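/-
Copyright: b2b-lace packet (CARVER gen 55).  [NoBLE17] §5.3.2 (5.40)–(5.41): MONOTONICITY of the x-slot right-hand
sides `bubbleSlotR` (`NobleBubbleLetterSums`) and `triangleSlotR` (`NobleTriangleLetterSums`) in the letter parameters
`(p, Γ̄, R₁, R₂[, R₃])`.  Proofs only; no named fact; no numeral; no dimension.
-/
import Literature.Probability.FitznerVanDerHofstad2017.NobleBubbleLetterSums
import Literature.Probability.FitznerVanDerHofstad2017.NobleTriangleLetterSums
import HarnessLib

/-!
# [NoBLE17] (5.40)–(5.41): the x-slot right-hand sides are monotone in the letter parameters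

Reproduction module (build `lace`, LEAN-IN-TREE RULE) in the package of
R. Fitzner, R. van der Hofstad, *Mean-field behavior for nearest-neighbor percolation in `d > 10`*,
Electron. J. Probab. **22** (2017) no. 43 [FvdH17], whose numerical bounds on the simple diagrams are those of
R. Fitzner, R. van der Hofstad, *Generalized approach to the non-backtracking lace expansion*, Probab. Theory Relat.
Fields **169** (2017) 1041–1119 [NoBLE17], §5.3.2: the split bounds (5.40) (bubble) and (5.41) (triangle), typed in the
tree as `NobleBlocks.bubbleSlotR p Γ̄ m₁ m₂ M N R₁ R₂ = Σ_{L ∈ [m₁+m₂, M)} (L+1−m₁−m₂)·N L·p^L + (M−m₁−m₂)·p^M·Γ̄·R₁ +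
p^M·Γ̄²·R₂` and `NobleBlocks.triangleSlotR p Γ̄ m₁ m₂ m₃ M N R₁ R₂ R₃` (binomial weights, three remainder constants).

Both right-hand sides are finite sums of monomials in `(p, Γ̄, R₁, R₂, R₃)` with NONNEGATIVE coefficients, hence
monotone in each parameter on the nonnegative orthant:
* `bubbleSlotR_mono` — `0 ≤ p ≤ p'`, `0 ≤ Γ̄ ≤ Γ̄'`, `0 ≤ R₁ ≤ R₁'`, `0 ≤ R₂ ≤ R₂'` ⇒
  `bubbleSlotR p Γ̄ m₁ m₂ M N R₁ R₂ ≤ bubbleSlotR p' Γ̄' m₁ m₂ M N R₁' R₂'`;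
* `triangleSlotR_mono` — the same for (5.41) with `0 ≤ R₃ ≤ R₃'`.

USE (why this is typed): the entry bounds of the N-level x-space stack (`NobleExactLegSlots*`, `NobleEntry*`,
`NobleBubbleLetterSums`, `NobleTriangleLetterSums`) are stated at the percolation parameter `p` itself and at
`Γ̄ = Γ̄₂(p) = nobleSup2 d p`; a bound UNIFORM over an interval of `p` (as the hypotheses packages of [FvdH17] §4 quantify)
is read off by replacing `p` and `Γ̄₂(p)` by majorants (`(2d−1)p ≤ Γ₁`, `Γ̄₂(p) ≤ (2d−2)/(2d−1)·Γ₂`) — which is exactly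
this monotonicity (companions of the landed count-monotonicity `bubbleSlotR_mono_count` / `triangleSlotR_mono_count`).
Any `d`; nothing landed is modified; no cited hypothesis; no numeral; no sentence about any particular dimension.
-/

namespace Literature.Probability.FitznerVanDerHofstad2017.NobleBlocks

open Finset
open scoped BigOperators

/-- **Monotonicity of the (5.40) slot in the letter parameters**: for `0 ≤ p ≤ p'`, `0 ≤ Γ̄ ≤ Γ̄'`,
`0 ≤ R₁ ≤ R₁'`, `0 ≤ R₂ ≤ R₂'`, `bubbleSlotR p Γ̄ m₁ m₂ M N R₁ R₂ ≤ bubbleSlotR p' Γ̄' m₁ m₂ M N R₁' R₂'`.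
[cite: FitznerVanDerHofstad2016NoBLE, §5.3.2 (5.40) (PTRF 169 (2017) p. 1098)] -/
theorem bubbleSlotR_mono {p p' Γ Γ' R₁ R₁' R₂ R₂' : ℝ} (hp : 0 ≤ p) (hpp' : p ≤ p') (hΓ : 0 ≤ Γ)
    (hΓΓ' : Γ ≤ Γ') (hR₁ : 0 ≤ R₁) (hR₁' : R₁ ≤ R₁') (hR₂ : 0 ≤ R₂) (hR₂' : R₂ ≤ R₂')
    (m₁ m₂ M : ℕ) (N : ℕ → ℕ) :
    bubbleSlotR p Γ m₁ m₂ M N R₁ R₂ ≤ bubbleSlotR p' Γ' m₁ m₂ M N R₁' R₂' := by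
  have hp' : 0 ≤ p' := hp.trans hpp'
  have hΓ' : 0 ≤ Γ' := hΓ.trans hΓΓ'
  have hR₁'' : 0 ≤ R₁' := hR₁.trans hR₁'
  have hR₂'' : 0 ≤ R₂' := hR₂.trans hR₂'
  have hpow : ∀ n : ℕ, p ^ n ≤ p' ^ n := fun n => pow_le_pow_left₀ hp hpp' n
  unfold bubbleSlotR
  apply add_le_add
  apply add_le_add
  · apply Finset.sum_le_sum
    intro L _
    exact mul_le_mul_of_nonneg_left (hpow L) (by positivity)
  · apply mul_le_mul_of_nonneg_left _ (by positivity)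
    apply mul_le_mul (hpow M) (mul_le_mul hΓΓ' hR₁' hR₁ hΓ') (mul_nonneg hΓ hR₁) (pow_nonneg hp' M)
  · apply mul_le_mul (hpow M) _ (mul_nonneg (pow_nonneg hΓ 2) hR₂) (pow_nonneg hp' M)
    exact mul_le_mul (pow_le_pow_left₀ hΓ hΓΓ' 2) hR₂' hR₂ (pow_nonneg hΓ' 2)

/-- **Monotonicity of the (5.41) slot in the letter parameters** (`0 ≤ p ≤ p'`, `0 ≤ Γ̄ ≤ Γ̄'`, `0 ≤ Rᵢ ≤ Rᵢ'`).
[cite: FitznerVanDerHofstad2016NoBLE, §5.3.2 (5.41) (PTRF 169 (2017) p. 1098)] -/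
theorem triangleSlotR_mono {p p' Γ Γ' R₁ R₁' R₂ R₂' R₃ R₃' : ℝ} (hp : 0 ≤ p) (hpp' : p ≤ p') (hΓ : 0 ≤ Γ)
    (hΓΓ' : Γ ≤ Γ') (hR₁ : 0 ≤ R₁) (hR₁' : R₁ ≤ R₁') (hR₂ : 0 ≤ R₂) (hR₂' : R₂ ≤ R₂')
    (hR₃ : 0 ≤ R₃) (hR₃' : R₃ ≤ R₃') (m₁ m₂ m₃ M : ℕ) (N : ℕ → ℕ) :
    triangleSlotR p Γ m₁ m₂ m₃ M N R₁ R₂ R₃ ≤ triangleSlotR p' Γ' m₁ m₂ m₃ M N R₁' R₂' R₃' := by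
  have hp' : 0 ≤ p' := hp.trans hpp'
  have hΓ' : 0 ≤ Γ' := hΓ.trans hΓΓ'
  have hpow : ∀ n : ℕ, p ^ n ≤ p' ^ n := fun n => pow_le_pow_left₀ hp hpp' n
  have hΓpow : ∀ n : ℕ, Γ ^ n ≤ Γ' ^ n := fun n => pow_le_pow_left₀ hΓ hΓΓ' n
  unfold triangleSlotR
  apply add_le_add
  apply add_le_add
  apply add_le_add
  · apply Finset.sum_le_sum
    intro L _
    exact mul_le_mul_of_nonneg_left (hpow L) (by positivity)
  · apply mul_le_mul_of_nonneg_left _ (by positivity)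
    exact mul_le_mul (hpow M) (mul_le_mul hΓΓ' hR₁' hR₁ hΓ') (mul_nonneg hΓ hR₁) (pow_nonneg hp' M)
  · apply mul_le_mul_of_nonneg_left _ (by positivity)
    exact mul_le_mul (hpow M) (mul_le_mul (hΓpow 2) hR₂' hR₂ (pow_nonneg hΓ' 2))
      (mul_nonneg (pow_nonneg hΓ 2) hR₂) (pow_nonneg hp' M)
  · exact mul_le_mul (hpow M) (mul_le_mul (hΓpow 3) hR₃' hR₃ (pow_nonneg hΓ' 3))
      (mul_nonneg (pow_nonneg hΓ 3) hR₃) (pow_nonneg hp' M)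

end Literature.Probability.FitznerVanDerHofstad2017.NobleBlocks
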